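import Literature.NumberTheory.Transcendental.KaehlerHodgeLaplacianProofs
import Literature.NumberTheory.Transcendental.KaehlerHodgeSmoothProofs

/-!
# Kähler identities ⇒ `Δ_d = 2Δ_∂̄`: the algebraic step (Huybrechts Prop. 3.1.12 (iii), second half)

Trunk **T-KAEHLER** (`NumberTheory/Transcendental`), theorems-only sequel of
`KaehlerHodgeLaplacianProofs.lean`, serving the named fact
`Literature.NumberTheory.Transcendental.cHodgeLaplacian_eq_two_smul_dolbeaultLaplacian` of
`KaehlerHodge.lean` (Kähler identity `Δ_d = 2Δ_∂̄`; Voisin (2002), Thm. 6.7; Huybrechts (2005),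
Prop. 3.1.12 (iii)) in the same way as that file serves `Δ_∂̄ = Δ_∂`.

Huybrechts' proof of (iii), p. 122: "We first show that `∂∂̄* + ∂̄*∂ = 0`. Indeed, assertion ii)
yields `i(∂∂̄* + ∂̄*∂) = ∂[Λ,∂] + [Λ,∂]∂ = ∂Λ∂ - ∂Λ∂ = 0`. … In order to compare `Δ` with `Δ_∂`,
write `Δ = (∂ + ∂̄)(∂* + ∂̄*) + (∂* + ∂̄*)(∂ + ∂̄) = Δ_∂ + Δ_∂̄ + (∂∂̄* + ∂̄*∂) +
\overline{(∂∂̄* + ∂̄*∂)} = Δ_∂ + Δ_∂̄ = 2Δ_∂`" (and `Δ_∂ = Δ_∂̄`). This file proves exactly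
this, for an arbitrary contraction family `Λ` subject to the first-order Kähler identities
`KaehlerIdentities o Λ` of `KaehlerHodgeLaplacianProofs.lean` (Voisin (2002), Prop. 6.5), on a
complex manifold whose real tangent bundle carries a *smooth* metric (Warner (1983), 4.10) and an
orientation family with smooth volume form:

* `d* = ∂* + ∂̄*` on smooth forms (`cmcoderiv_eq_dolbeaultAdjoint_add_dolbeaultBarAdjoint'`,
  Huybrechts (2005), Lemma 3.1.4; from `d = ∂ + ∂̄` applied to the smooth form `⋆α` and `δ = -⋆d⋆`
  in even real dimension), smoothness and additivity of `∂*`, `∂̄*` on smooth forms;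
* the mixed anticommutators `∂∂̄* + ∂̄*∂ = 0`, `∂̄∂* + ∂*∂̄ = 0` from `KaehlerIdentities o Λ` and
  `∂² = 0`, `∂̄² = 0` (with the truncations in degree `0` and in top degree);
* `KaehlerIdentities.cHodgeLaplacian_eq_two_smul_dolbeaultLaplacian`: `Δ_d α = 2 Δ_∂̄ α` for
  every smooth complex form `α`, all four degree cases, using
  `KaehlerIdentities.dolbeaultLaplacian_eq_delLaplacian`;
* the named facts from the Kähler identities:
  `cHodgeLaplacian_eq_two_smul_dolbeaultLaplacian_of_kaehlerIdentities` (the fact as declared)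
  and `…_of_isManifold_complex_of_kaehlerIdentities` (its corrected statement in
  `KaehlerHodge.lean`, *Correction*).

No named fact is introduced or discharged; what remains for both Laplacian comparisons is
Voisin's Prop. 6.5 for the genuine contraction `Λ = ⋆⁻¹L⋆` of a Kähler metric.

## References

* D. Huybrechts, *Complex Geometry. An Introduction* (2005), §3.1, Lemma 3.1.4, Prop. 3.1.12
  and its proof (pp. 120–122).
* C. Voisin, *Hodge Theory and Complex Algebraic Geometry I* (2002), §6.1.1 Prop. 6.5,
  §6.1.2 Thm. 6.7 (p. 141).
* F. W. Warner, *Foundations of Differentiable Manifolds and Lie Groups* (1983), 4.10, 6.1.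
-/

noncomputable section

open scoped Manifold ContDiff
open Bundle Module

namespace Literature.NumberTheory.Transcendental

open Literature.Geometry.Kaehler (MForm IsSmoothForm riemannianVolumeForm mextDeriv)

variable {E : Type*} [NormedAddCommGroup E] [NormedSpace ℂ E]
  {M : Type*} [TopologicalSpace M] [ChartedSpace E M]
  [FiniteDimensional ℂ E] {n : ℕ} [Fact (finrank ℝ E = n)]
  [RiemannianBundle (fun x : M ↦ TangentSpace 𝓘(ℝ, E) x)]
  (o : (x : M) → Orientation ℝ (TangentSpace 𝓘(ℝ, E) x) (Fin n))
  [IsManifold 𝓘(ℂ, E) ω M] [IsManifold 𝓘(ℝ, E) ∞ M]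
  [IsContMDiffRiemannianBundle 𝓘(ℝ, E) ∞ E (fun x : M ↦ TangentSpace 𝓘(ℝ, E) x)]

/-! ### `∂*`, `∂̄*` on smooth forms of a complex manifold with smooth metric -/

section Adjoints

variable {k m : ℕ}

/-- `∂̄*α = -⋆∂⋆α` is smooth for smooth `α` (smooth metric, orientation with smooth volume form,
holomorphic atlas). Huybrechts (2005), §3.1, Def. 3.1.3. [cite: Huybrechts2005, Def. 3.1.3] -/
theorem _root_.Literature.Geometry.Kaehler.IsSmoothForm.dolbeaultBarAdjoint
    (ho : IsSmoothForm (riemannianVolumeForm o)) (h : (k + 1) + m = n)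
    {α : MForm 𝓘(ℝ, E) M ℂ (k + 1)} (hα : IsSmoothForm α) :
    IsSmoothForm (dolbeaultBarAdjoint o h α) := by
  unfold Literature.NumberTheory.Transcendental.dolbeaultBarAdjoint
  exact (IsSmoothForm.cHodgeStar o ho _ (IsSmoothForm.cHodgeStar o ho h hα).dolbeault).neg'

/-- `∂*α = -⋆∂̄⋆α` is smooth for smooth `α` (smooth metric, orientation with smooth volume form,
holomorphic atlas). Huybrechts (2005), §3.1, Def. 3.1.3. [cite: Huybrechts2005, Def. 3.1.3] -/
theorem _root_.Literature.Geometry.Kaehler.IsSmoothForm.dolbeaultAdjoint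
    (ho : IsSmoothForm (riemannianVolumeForm o)) (h : (k + 1) + m = n)
    {α : MForm 𝓘(ℝ, E) M ℂ (k + 1)} (hα : IsSmoothForm α) :
    IsSmoothForm (dolbeaultAdjoint o h α) := by
  unfold Literature.NumberTheory.Transcendental.dolbeaultAdjoint
  exact (IsSmoothForm.cHodgeStar o ho _ (IsSmoothForm.cHodgeStar o ho h hα).dolbeaultBar).neg'

/-- `∂̄*` is additive on smooth forms (`⋆` is linear, `∂` is additive on the smooth forms
`⋆α`, `⋆β`). Huybrechts (2005), §3.1, Def. 3.1.3. [cite: Huybrechts2005, Def. 3.1.3] -/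
theorem dolbeaultBarAdjoint_add (ho : IsSmoothForm (riemannianVolumeForm o))
    (h : (k + 1) + m = n) {α β : MForm 𝓘(ℝ, E) M ℂ (k + 1)} (hα : IsSmoothForm α)
    (hβ : IsSmoothForm β) :
    dolbeaultBarAdjoint o h (α + β) = dolbeaultBarAdjoint o h α + dolbeaultBarAdjoint o h β := by
  unfold dolbeaultBarAdjoint
  rw [map_add, dolbeault_add' (IsSmoothForm.cHodgeStar o ho h hα)
    (IsSmoothForm.cHodgeStar o ho h hβ), map_add, neg_add]

/-- `∂*` is additive on smooth forms. Huybrechts (2005), §3.1, Def. 3.1.3. [cite: Huybrechts2005, Def. 3.1.3] -/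
theorem dolbeaultAdjoint_add (ho : IsSmoothForm (riemannianVolumeForm o))
    (h : (k + 1) + m = n) {α β : MForm 𝓘(ℝ, E) M ℂ (k + 1)} (hα : IsSmoothForm α)
    (hβ : IsSmoothForm β) :
    dolbeaultAdjoint o h (α + β) = dolbeaultAdjoint o h α + dolbeaultAdjoint o h β := by
  unfold dolbeaultAdjoint
  rw [map_add, dolbeaultBar_add' (IsSmoothForm.cHodgeStar o ho h hα)
    (IsSmoothForm.cHodgeStar o ho h hβ), map_add, neg_add]

/-- **`d* = ∂* + ∂̄*` on smooth forms** of a complex manifold with a smooth metric: from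
`δ = -⋆d⋆` (`cmcoderiv_eq_neg`, even real dimension) and `d = ∂ + ∂̄` on the smooth form `⋆α`
(`mextDeriv_eq_dolbeault_add_dolbeaultBar_holds`, `IsSmoothForm.cHodgeStar`). This is the named
fact `cmcoderiv_eq_dolbeaultAdjoint_add_dolbeaultBarAdjoint o` of `KaehlerHodge.lean` under its
intended (but, as declared, dropped) instances; Huybrechts (2005), Lemma 3.1.4 ("`d* = ∂* + ∂̄*`");
Griffiths–Harris (1978), p. 82. [cite: Huybrechts2005, Lemma 3.1.4] -/
theorem cmcoderiv_eq_dolbeaultAdjoint_add_dolbeaultBarAdjoint'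
    (ho : IsSmoothForm (riemannianVolumeForm o)) (h : (k + 1) + m = n)
    {α : MForm 𝓘(ℝ, E) M ℂ (k + 1)} (hα : IsSmoothForm α) :
    cmcoderiv o h α = dolbeaultAdjoint o h α + dolbeaultBarAdjoint o h α := by
  rw [cmcoderiv_eq_neg, mextDeriv_eq_dolbeault_add_dolbeaultBar_holds
    (IsSmoothForm.cHodgeStar o ho h hα), map_add, neg_add, dolbeaultAdjoint, dolbeaultBarAdjoint,
    add_comm]

/-- Under the intended instances (holomorphic atlas, smooth metric), the over-general named fact
`cmcoderiv_eq_dolbeaultAdjoint_add_dolbeaultBarAdjoint o` of `KaehlerHodge.lean` (which, as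
declared, lost these section instances) holds. Huybrechts (2005), Lemma 3.1.4. [cite: Huybrechts2005, Lemma 3.1.4] -/
theorem cmcoderiv_eq_dolbeaultAdjoint_add_dolbeaultBarAdjoint_of_contMDiffMetric :
    cmcoderiv_eq_dolbeaultAdjoint_add_dolbeaultBarAdjoint (k := k) (m := m) o :=
  fun ho h _ hα ↦ cmcoderiv_eq_dolbeaultAdjoint_add_dolbeaultBarAdjoint' o ho h hα

end Adjoints

/-! ### Mixed anticommutators from the Kähler identities -/

namespace KaehlerIdentities

variable {o} {Λ : (j : ℕ) → MForm 𝓘(ℝ, E) M ℂ (j + 2) → MForm 𝓘(ℝ, E) M ℂ j}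
  (hΛ : KaehlerIdentities o Λ)
include hΛ

omit [IsContMDiffRiemannianBundle 𝓘(ℝ, E) ∞ E (fun x : M ↦ TangentSpace 𝓘(ℝ, E) x)] in
/-- `∂̄*∂f = 0` on functions: `∂̄*∂f = -iΛ∂∂f = 0` (`∂² = 0`). Huybrechts (2005), proof of
Prop. 3.1.12 (iii) (degree-`0` truncation of `∂∂̄* + ∂̄*∂ = 0`). [cite: Huybrechts2005, Prop. 3.1.12 (iii)] -/
theorem dolbeaultBarAdjoint_dolbeault_zero {m : ℕ} (h : (0 + 1) + m = n)
    {f : MForm 𝓘(ℝ, E) M ℂ 0} (hf : IsSmoothForm f) :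
    dolbeaultBarAdjoint o h (dolbeault f) = 0 := by
  rw [hΛ.dolbeaultBarAdjoint_eq_one h hf.dolbeault, dolbeault_dolbeault_holds hf, hΛ.map_zero,
    smul_zero, neg_zero]

omit [IsContMDiffRiemannianBundle 𝓘(ℝ, E) ∞ E (fun x : M ↦ TangentSpace 𝓘(ℝ, E) x)] in
/-- `∂*∂̄f = 0` on functions: `∂*∂̄f = iΛ∂̄∂̄f = 0` (`∂̄² = 0`). Huybrechts (2005), proof of
Prop. 3.1.12 (iii). [cite: Huybrechts2005, Prop. 3.1.12 (iii)] -/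
theorem dolbeaultAdjoint_dolbeaultBar_zero {m : ℕ} (h : (0 + 1) + m = n)
    {f : MForm 𝓘(ℝ, E) M ℂ 0} (hf : IsSmoothForm f) :
    dolbeaultAdjoint o h (dolbeaultBar f) = 0 := by
  rw [hΛ.dolbeaultAdjoint_eq_one h hf.dolbeaultBar, dolbeaultBar_dolbeaultBar_holds hf,
    hΛ.map_zero, smul_zero]

omit [IsContMDiffRiemannianBundle 𝓘(ℝ, E) ∞ E (fun x : M ↦ TangentSpace 𝓘(ℝ, E) x)] in
/-- **`∂∂̄* + ∂̄*∂ = 0`** on smooth forms of positive degree: `i(∂∂̄* + ∂̄*∂) = ∂[Λ,∂] + [Λ,∂]∂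
= ∂Λ∂ - ∂∂Λ + Λ∂∂ - ∂Λ∂ = 0` by `∂² = 0`. Huybrechts (2005), proof of Prop. 3.1.12 (iii),
p. 122 ("We first show that `∂∂̄* + ∂̄*∂ = 0`"). [cite: Huybrechts2005, Prop. 3.1.12 (iii)] -/
theorem dolbeault_dolbeaultBarAdjoint_add {k m : ℕ} (h : (k + 1) + (m + 1) = n)
    (h' : (k + 1 + 1) + m = n) {α : MForm 𝓘(ℝ, E) M ℂ (k + 1)} (hα : IsSmoothForm α) :
    dolbeault (dolbeaultBarAdjoint o h α) + dolbeaultBarAdjoint o h' (dolbeault α) = 0 := by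
  rcases k with - | j
  · rw [hΛ.dolbeaultBarAdjoint_eq_one h hα, hΛ.dolbeaultBarAdjoint_eq h' hα.dolbeault,
      dolbeault_dolbeault_holds hα, hΛ.map_zero, zero_sub, smul_neg, neg_neg, dolbeault_neg,
      dolbeault_smul_holds Complex.I, neg_add_cancel]
  · rw [hΛ.dolbeaultBarAdjoint_eq h hα, hΛ.dolbeaultBarAdjoint_eq h' hα.dolbeault,
      dolbeault_dolbeault_holds hα, hΛ.map_zero, zero_sub, smul_neg, neg_neg, dolbeault_neg,
      dolbeault_smul_holds Complex.I,
      dolbeault_sub (hΛ.isSmoothForm_map _ hα.dolbeault) (hΛ.isSmoothForm_map _ hα).dolbeault,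
      dolbeault_dolbeault_holds (hΛ.isSmoothForm_map _ hα), sub_zero, neg_add_cancel]

omit [IsContMDiffRiemannianBundle 𝓘(ℝ, E) ∞ E (fun x : M ↦ TangentSpace 𝓘(ℝ, E) x)] in
/-- **`∂̄∂* + ∂*∂̄ = 0`** on smooth forms of positive degree (the conjugate identity:
`-i(∂̄∂* + ∂*∂̄) = ∂̄[Λ,∂̄] + [Λ,∂̄]∂̄ = 0` by `∂̄² = 0`). Huybrechts (2005), proof of
Prop. 3.1.12 (iii), p. 122. [cite: Huybrechts2005, Prop. 3.1.12 (iii)] -/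
theorem dolbeaultBar_dolbeaultAdjoint_add {k m : ℕ} (h : (k + 1) + (m + 1) = n)
    (h' : (k + 1 + 1) + m = n) {α : MForm 𝓘(ℝ, E) M ℂ (k + 1)} (hα : IsSmoothForm α) :
    dolbeaultBar (dolbeaultAdjoint o h α) + dolbeaultAdjoint o h' (dolbeaultBar α) = 0 := by
  rcases k with - | j
  · rw [hΛ.dolbeaultAdjoint_eq_one h hα, hΛ.dolbeaultAdjoint_eq h' hα.dolbeaultBar,
      dolbeaultBar_dolbeaultBar_holds hα, hΛ.map_zero, zero_sub,
      dolbeaultBar_smul_holds Complex.I, smul_neg, add_neg_cancel]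
  · rw [hΛ.dolbeaultAdjoint_eq h hα, hΛ.dolbeaultAdjoint_eq h' hα.dolbeaultBar,
      dolbeaultBar_dolbeaultBar_holds hα, hΛ.map_zero, zero_sub,
      dolbeaultBar_smul_holds Complex.I,
      dolbeaultBar_sub (hΛ.isSmoothForm_map _ hα.dolbeaultBar)
        (hΛ.isSmoothForm_map _ hα).dolbeaultBar,
      dolbeaultBar_dolbeaultBar_holds (hΛ.isSmoothForm_map _ hα), sub_zero, smul_neg,
      add_neg_cancel]

omit [IsContMDiffRiemannianBundle 𝓘(ℝ, E) ∞ E (fun x : M ↦ TangentSpace 𝓘(ℝ, E) x)] in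
/-- In top degree `k + 1 = n` the mixed terms vanish separately: `∂∂̄*α = 0` and `∂̄∂*α = 0`
(there `∂α = ∂̄α = 0`, so `∂̄*α = i∂Λα`, `∂*α = -i∂̄Λα`, killed by `∂² = 0`, `∂̄² = 0`).
Huybrechts (2005), proof of Prop. 3.1.12 (iii) (top-degree truncation). [cite: Huybrechts2005, Prop. 3.1.12 (iii)] -/
theorem dolbeault_dolbeaultBarAdjoint_top {k : ℕ} (h : (k + 1) + 0 = n)
    {α : MForm 𝓘(ℝ, E) M ℂ (k + 1)} (hα : IsSmoothForm α) :
    dolbeault (dolbeaultBarAdjoint o h α) = 0 ∧ dolbeaultBar (dolbeaultAdjoint o h α) = 0 := by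
  rcases k with - | j
  · rw [hΛ.dolbeaultBarAdjoint_eq_one h hα, hΛ.dolbeaultAdjoint_eq_one h hα,
      cform_eq_zero_of_finrank_lt (n := n) (by omega) (dolbeault α),
      cform_eq_zero_of_finrank_lt (n := n) (by omega) (dolbeaultBar α), hΛ.map_zero, smul_zero,
      neg_zero, dolbeault_zero, dolbeaultBar_zero]
    exact ⟨rfl, rfl⟩
  · have hΛα : IsSmoothForm (Λ j α) := hΛ.isSmoothForm_map j hα
    rw [hΛ.dolbeaultBarAdjoint_eq h hα, hΛ.dolbeaultAdjoint_eq h hα,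
      cform_eq_zero_of_finrank_lt (n := n) (by omega) (dolbeault α),
      cform_eq_zero_of_finrank_lt (n := n) (by omega) (dolbeaultBar α), hΛ.map_zero, zero_sub,
      zero_sub, smul_neg, neg_neg, smul_neg, dolbeault_smul_holds Complex.I,
      dolbeault_dolbeault_holds hΛα, smul_zero, dolbeaultBar_neg,
      dolbeaultBar_smul_holds Complex.I, dolbeaultBar_dolbeaultBar_holds hΛα, smul_zero, neg_zero]
    exact ⟨rfl, rfl⟩

/-- **Kähler identities ⇒ `Δ_d = 2Δ_∂̄`** (Huybrechts (2005), Prop. 3.1.12 (iii), proof p. 122;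
Voisin (2002), Thm. 6.7, p. 141). On a complex manifold `M` with a smooth metric on its real
tangent bundle and an orientation family `o` with smooth volume form, if a contraction family `Λ`
satisfies the first-order Kähler identities `KaehlerIdentities o Λ`, then the complexified
Hodge–de Rham Laplacian `Δ_d = dδ + δd` (`cHodgeLaplacian`, `δ = -⋆d⋆`) and the `∂̄`-Laplacian
`Δ_∂̄ = ∂̄∂̄* + ∂̄*∂̄` (`dolbeaultLaplacian`) satisfy `Δ_d α = 2 Δ_∂̄ α` for every smooth complex
`k`-form `α` (`k + m = n`). Proof: `d = ∂ + ∂̄`, `d* = ∂* + ∂̄*`, so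
`Δ_d = Δ_∂ + Δ_∂̄ + (∂∂̄* + ∂̄*∂) + (∂̄∂* + ∂*∂̄) = Δ_∂ + Δ_∂̄`
(`dolbeault_dolbeaultBarAdjoint_add`, `dolbeaultBar_dolbeaultAdjoint_add`) `= 2Δ_∂̄`
(`dolbeaultLaplacian_eq_delLaplacian`); degree `0` and top degree are the corresponding
truncations. The Kähler condition enters only through `KaehlerIdentities o Λ`.
[cite: Huybrechts2005, Prop. 3.1.12 (iii)] -/
theorem cHodgeLaplacian_eq_two_smul_dolbeaultLaplacian
    (ho : IsSmoothForm (riemannianVolumeForm o)) {k m : ℕ} (h : k + m = n)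
    {α : MForm 𝓘(ℝ, E) M ℂ k} (hα : IsSmoothForm α) :
    cHodgeLaplacian o k m h α = (2 : ℂ) • dolbeaultLaplacian o k m h α := by
  have hΔ := hΛ.dolbeaultLaplacian_eq_delLaplacian h hα
  rcases k with - | k <;> rcases m with - | m
  · simp only [cHodgeLaplacian, dolbeaultLaplacian, smul_zero]
  · -- functions: `Δ_d f = (∂* + ∂̄*)(∂ + ∂̄) f = ∂*∂f + ∂̄*∂̄f = 2∂̄*∂̄f`
    simp only [cHodgeLaplacian, dolbeaultLaplacian, delLaplacian] at hΔ ⊢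
    rw [mextDeriv_eq_dolbeault_add_dolbeaultBar_holds hα,
      cmcoderiv_eq_dolbeaultAdjoint_add_dolbeaultBarAdjoint' o ho _
        (hα.dolbeault.add hα.dolbeaultBar),
      dolbeaultAdjoint_add o ho _ hα.dolbeault hα.dolbeaultBar,
      dolbeaultBarAdjoint_add o ho _ hα.dolbeault hα.dolbeaultBar,
      hΛ.dolbeaultBarAdjoint_dolbeault_zero _ hα, hΛ.dolbeaultAdjoint_dolbeaultBar_zero _ hα,
      ← hΔ, add_zero, zero_add, two_smul]
  · -- top degree: `Δ_d α = (∂ + ∂̄)(∂* + ∂̄*) α = ∂∂*α + ∂̄∂̄*α = 2∂̄∂̄*α`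
    simp only [cHodgeLaplacian, dolbeaultLaplacian, delLaplacian] at hΔ ⊢
    obtain ⟨h₁, h₂⟩ := hΛ.dolbeault_dolbeaultBarAdjoint_top (show (k + 1) + 0 = n by omega) hα
    rw [cmcoderiv_eq_dolbeaultAdjoint_add_dolbeaultBarAdjoint' o ho _ hα,
      mextDeriv_eq_dolbeault_add_dolbeaultBar_holds
        ((IsSmoothForm.dolbeaultAdjoint o ho _ hα).add (IsSmoothForm.dolbeaultBarAdjoint o ho _ hα)),
      dolbeault_add' (IsSmoothForm.dolbeaultAdjoint o ho _ hα)
        (IsSmoothForm.dolbeaultBarAdjoint o ho _ hα),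
      dolbeaultBar_add' (IsSmoothForm.dolbeaultAdjoint o ho _ hα)
        (IsSmoothForm.dolbeaultBarAdjoint o ho _ hα),
      h₁, h₂, ← hΔ, add_zero, zero_add, two_smul]
  · -- generic degrees
    simp only [cHodgeLaplacian, dolbeaultLaplacian, delLaplacian] at hΔ ⊢
    have hX := hΛ.dolbeault_dolbeaultBarAdjoint_add h (show (k + 1 + 1) + m = n by omega) hα
    have hY := hΛ.dolbeaultBar_dolbeaultAdjoint_add h (show (k + 1 + 1) + m = n by omega) hα
    rw [cmcoderiv_eq_dolbeaultAdjoint_add_dolbeaultBarAdjoint' o ho _ hα,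
      mextDeriv_eq_dolbeault_add_dolbeaultBar_holds
        ((IsSmoothForm.dolbeaultAdjoint o ho _ hα).add (IsSmoothForm.dolbeaultBarAdjoint o ho _ hα)),
      dolbeault_add' (IsSmoothForm.dolbeaultAdjoint o ho _ hα)
        (IsSmoothForm.dolbeaultBarAdjoint o ho _ hα),
      dolbeaultBar_add' (IsSmoothForm.dolbeaultAdjoint o ho _ hα)
        (IsSmoothForm.dolbeaultBarAdjoint o ho _ hα),
      mextDeriv_eq_dolbeault_add_dolbeaultBar_holds hα,
      cmcoderiv_eq_dolbeaultAdjoint_add_dolbeaultBarAdjoint' o ho _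
        (hα.dolbeault.add hα.dolbeaultBar),
      dolbeaultAdjoint_add o ho _ hα.dolbeault hα.dolbeaultBar,
      dolbeaultBarAdjoint_add o ho _ hα.dolbeault hα.dolbeaultBar,
      eq_neg_of_add_eq_zero_left hX, eq_neg_of_add_eq_zero_left hY, two_smul]
    nth_rw 1 [hΔ]
    abel

end KaehlerIdentities

/-! ### The named facts `Δ_d = 2Δ_∂̄`, from the Kähler identities -/

section NamedFact

omit [RiemannianBundle (fun x : M ↦ TangentSpace 𝓘(ℝ, E) x)]
  [IsContMDiffRiemannianBundle 𝓘(ℝ, E) ∞ E (fun x : M ↦ TangentSpace 𝓘(ℝ, E) x)]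

variable (g : ContMDiffRiemannianMetric 𝓘(ℝ, E) ∞ E (fun x : M ↦ TangentSpace 𝓘(ℝ, E) x))

/-- **What remains of `Δ_d = 2Δ_∂̄`.** On a complex manifold with a smooth metric `g`, the named
fact `cHodgeLaplacian_eq_two_smul_dolbeaultLaplacian g o` of `KaehlerHodge.lean` (Voisin (2002),
Thm. 6.7; Huybrechts (2005), Prop. 3.1.12 (iii)) in degrees `(k, m)` follows from the first-order
Kähler identities `KaehlerIdentities o Λ` for some contraction family `Λ` of the metric `g`
(Voisin (2002), Prop. 6.5, for `Λ = ⋆⁻¹L⋆` when `g` is Kähler), by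
`KaehlerIdentities.cHodgeLaplacian_eq_two_smul_dolbeaultLaplacian`; the smoothness of the metric
is Mathlib's instance for `⟨g.toRiemannianMetric⟩`. [cite: Huybrechts2005, Prop. 3.1.12 (iii)] -/
theorem cHodgeLaplacian_eq_two_smul_dolbeaultLaplacian_of_kaehlerIdentities {k m : ℕ}
    {Λ : (j : ℕ) → MForm 𝓘(ℝ, E) M ℂ (j + 2) → MForm 𝓘(ℝ, E) M ℂ j}
    (hΛ : letI : RiemannianBundle (fun x : M ↦ TangentSpace 𝓘(ℝ, E) x) := ⟨g.toRiemannianMetric⟩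
      KaehlerIdentities o Λ) :
    cHodgeLaplacian_eq_two_smul_dolbeaultLaplacian (k := k) (m := m) g o := by
  intro _ h α hα
  letI : RiemannianBundle (fun x : M ↦ TangentSpace 𝓘(ℝ, E) x) := ⟨g.toRiemannianMetric⟩
  intro ho
  exact hΛ.cHodgeLaplacian_eq_two_smul_dolbeaultLaplacian ho h hα

/-- The **corrected** named fact `cHodgeLaplacian_eq_two_smul_dolbeaultLaplacian_of_isManifold_complex
g o` (`KaehlerHodge.lean`, *Correction*: the holomorphic atlas as a binder of the `def`) from the
first-order Kähler identities for some contraction family `Λ` of `g`. Huybrechts (2005),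
Prop. 3.1.12 (ii) ⇒ (iii). [cite: Huybrechts2005, Prop. 3.1.12 (iii)] -/
theorem cHodgeLaplacian_eq_two_smul_dolbeaultLaplacian_of_isManifold_complex_of_kaehlerIdentities
    {k m : ℕ} {Λ : (j : ℕ) → MForm 𝓘(ℝ, E) M ℂ (j + 2) → MForm 𝓘(ℝ, E) M ℂ j}
    (hΛ : letI : RiemannianBundle (fun x : M ↦ TangentSpace 𝓘(ℝ, E) x) := ⟨g.toRiemannianMetric⟩
      KaehlerIdentities o Λ) :
    cHodgeLaplacian_eq_two_smul_dolbeaultLaplacian_of_isManifold_complex (k := k) (m := m) g o :=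
  (cHodgeLaplacian_eq_two_smul_dolbeaultLaplacian_of_isManifold_complex_iff g o).2
    (cHodgeLaplacian_eq_two_smul_dolbeaultLaplacian_of_kaehlerIdentities o g hΛ)

end NamedFact

end Literature.NumberTheory.Transcendental
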